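import Summits.Ventures.HodgeRepro2.T5HermitianInertia

/-!
# Sylvester's law of inertia for hermitian matrices over `ℂ` — the eigenvalue count (cell pub-hodge-repro2, seat p3)

Companion of T5HermitianInertia (uniqueness of the `±1` counts of a normal form `Pᴴ M P = diag(±1)`).
The cell reads «signature (p, q)» (Liu 2021 p. 107 ll. 21–23; B1 ll. 33 / 41) in two ways — as a
Sylvester normal form (t6-p4's `HasSig`) and as an eigenvalue count (p2's `signatureAt`). Here, Mathlib-only:

* `isUnit_det_of_conjTranspose_mul_eq_diagonal` — a normal form `diag(±1)` forces `M` invertible;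
* `exists_conjTranspose_mul_eq_diagonal_sign` — the EXISTENCE half for an invertible hermitian `M`
  (spectral theorem + the rescaling `U · diag((√|λᵢ|)⁻¹)` of the eigenvector unitary), with the `+1`'s
  exactly at the positive eigenvalues;
* `card_one_eq_card_pos_eigenvalues` / `card_neg_one_eq_card_neg_eigenvalues` — in ANY normal form of
  a hermitian `M`, `#{+1} = #{i | 0 < λᵢ}` and `#{−1} = #{i | λᵢ < 0}` (Mathlib's
  `Matrix.IsHermitian.eigenvalues`); `eq_card_pos_eigenvalues_of_conjTranspose_mul_eq_diagonal_pmVec`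
  for `diag(1^p, (−1)^q)` on `Fin n`: `p` = the number of positive eigenvalues.

So the two readings of «signature» are one invariant. No display; no device.
§8(d): uses an L-value-free non-vanishing device: NO.
-/

namespace Summit.Ventures.HodgeRepro2.T5HermitianInertiaSpectral

open Matrix Finset T5HermitianInertia

variable {ι : Type*} [Fintype ι] [DecidableEq ι]

/-! ## A normal form is only possible for an invertible matrix -/

/-- `Pᴴ M P = diag(±1)` forces `M` invertible (and `P` too — not needed here). -/
theorem isUnit_det_of_conjTranspose_mul_eq_diagonal {M P : Matrix ι ι ℂ} {d : ι → ℂ}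
    (hd : ∀ i, d i = 1 ∨ d i = -1) (hPM : Pᴴ * M * P = diagonal d) :
    IsUnit M.det := by
  have hdet : (Pᴴ * M * P).det = (diagonal d).det := by rw [hPM]
  rw [det_mul, det_mul, det_conjTranspose, det_diagonal] at hdet
  have hprod : ∏ i, d i ≠ 0 := by
    rw [Finset.prod_ne_zero_iff]
    intro i _
    rcases hd i with h | h <;> simp [h]
  rw [isUnit_iff_ne_zero]
  intro hM
  rw [hM, mul_zero, zero_mul] at hdet
  exact hprod hdet.symm

/-! ## The eigenvalue count -/

section Spectral

variable {M : Matrix ι ι ℂ} (hM : M.IsHermitian)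

/-- The eigenvalues of an invertible hermitian matrix are non-zero. -/
theorem eigenvalues_ne_zero_of_isUnit_det (hdet : IsUnit M.det) (i : ι) :
    hM.eigenvalues i ≠ 0 := by
  intro h0
  have := hM.det_eq_prod_eigenvalues
  rw [isUnit_iff_ne_zero, this, Finset.prod_ne_zero_iff] at hdet
  exact hdet i (Finset.mem_univ i) (by simp [h0])

/-- The sign of a real number, as `1` or `−1` (`1` at `0`). -/
noncomputable def sgn (x : ℝ) : ℂ := if 0 < x then 1 else -1

/-- `sgn x` is `1` or `−1`. -/
theorem sgn_mem_pm (x : ℝ) : sgn x = 1 ∨ sgn x = -1 := by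
  unfold sgn; split_ifs <;> simp

/-- `sgn x = 1` exactly for `0 < x`. -/
theorem sgn_eq_one_iff (x : ℝ) : sgn x = 1 ↔ 0 < x := by
  unfold sgn
  split_ifs with h
  · simp [h]
  · simp only [h, iff_false]
    intro h'
    have := congrArg Complex.re h'
    norm_num at this

/-- For `x ≠ 0`, `sgn x = −1` exactly for `x < 0`. -/
theorem sgn_eq_neg_one_iff {x : ℝ} (hx : x ≠ 0) : sgn x = -1 ↔ x < 0 := by
  unfold sgn
  split_ifs with h
  · constructor
    · intro h'
      have := congrArg Complex.re h'
      norm_num at this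
    · intro h'
      exact absurd h' (not_lt.2 h.le)
  · simp only [true_iff]
    exact lt_of_le_of_ne (not_lt.1 h) hx

/-- The rescaling `s i := (√|λ i|)⁻¹` of the eigenvector unitary. -/
noncomputable def scale (i : ι) : ℂ := ((Real.sqrt |hM.eigenvalues i|)⁻¹ : ℝ)

/-- `sᵢ · λᵢ · sᵢ = sgn λᵢ` for the rescaling `sᵢ = (√|λᵢ|)⁻¹` (eigenvalues non-zero). -/
theorem scale_mul_eigenvalue_mul_scale (hdet : IsUnit M.det) (i : ι) :
    scale hM i * (hM.eigenvalues i : ℂ) * scale hM i = sgn (hM.eigenvalues i) := by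
  have hne := eigenvalues_ne_zero_of_isUnit_det hM hdet i
  have habs : 0 < |hM.eigenvalues i| := abs_pos.2 hne
  have hs : Real.sqrt |hM.eigenvalues i| * Real.sqrt |hM.eigenvalues i| = |hM.eigenvalues i| :=
    Real.mul_self_sqrt (abs_nonneg _)
  have hreal : (Real.sqrt |hM.eigenvalues i|)⁻¹ * hM.eigenvalues i *
      (Real.sqrt |hM.eigenvalues i|)⁻¹ = if 0 < hM.eigenvalues i then (1 : ℝ) else -1 := by
    rw [mul_comm ((Real.sqrt |hM.eigenvalues i|)⁻¹) (hM.eigenvalues i), mul_assoc, ← mul_inv, hs]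
    split_ifs with h
    · rw [abs_of_pos h]; exact mul_inv_cancel₀ hne
    · rw [abs_of_neg (lt_of_le_of_ne (not_lt.1 h) hne), inv_neg, mul_neg, mul_inv_cancel₀ hne]
  unfold scale sgn
  split_ifs with h
  · rw [if_pos h] at hreal; exact_mod_cast hreal
  · rw [if_neg h] at hreal; exact_mod_cast hreal

/-- **Existence of the Sylvester normal form** of an invertible hermitian matrix, with the
`+1`'s exactly at the positive eigenvalues: `P := U · diag(s)` with `U` the eigenvector unitary. -/
theorem exists_conjTranspose_mul_eq_diagonal_sign (hdet : IsUnit M.det) :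
    ∃ P : Matrix ι ι ℂ, IsUnit P.det ∧
      Pᴴ * M * P = diagonal (fun i => sgn (hM.eigenvalues i)) := by
  set U : Matrix ι ι ℂ := (hM.eigenvectorUnitary : Matrix ι ι ℂ) with hU
  have hdiag : star U * M * U = diagonal (RCLike.ofReal ∘ hM.eigenvalues) := by
    have := hM.conjStarAlgAut_star_eigenvectorUnitary
    rwa [Unitary.conjStarAlgAut_star_apply] at this
  refine ⟨U * diagonal (scale hM), ?_, ?_⟩
  · rw [det_mul, det_diagonal]
    refine (isUnit_iff_ne_zero.2 ?_).mul (isUnit_iff_ne_zero.2 ?_)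
    · have hmem := Matrix.det_of_mem_unitary hM.eigenvectorUnitary.2
      rw [Unitary.mem_iff] at hmem
      intro h0
      rw [h0, mul_zero] at hmem
      exact zero_ne_one hmem.1
    · rw [Finset.prod_ne_zero_iff]
      intro i _
      unfold scale
      have hne := eigenvalues_ne_zero_of_isUnit_det hM hdet i
      have : Real.sqrt |hM.eigenvalues i| ≠ 0 := by
        rw [Real.sqrt_ne_zero']
        exact abs_pos.2 hne
      exact_mod_cast inv_ne_zero this
  · have hstar : (diagonal (scale hM))ᴴ = diagonal (scale hM) := by
      rw [diagonal_conjTranspose]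
      congr 1
      ext i
      simp [scale]
    rw [conjTranspose_mul, hstar, ← star_eq_conjTranspose,
      Matrix.mul_assoc (diagonal (scale hM)) (star U) M,
      ← Matrix.mul_assoc (diagonal (scale hM) * (star U * M)) U (diagonal (scale hM)),
      Matrix.mul_assoc (diagonal (scale hM)) (star U * M) U, hdiag, diagonal_mul_diagonal,
      diagonal_mul_diagonal]
    congr 1
    ext i
    simp only [Function.comp_apply]
    exact scale_mul_eigenvalue_mul_scale hM hdet i

/-- **The two readings of «signature» agree:** in any normal form `Pᴴ M P = diag(±1)` of a
hermitian `M`, the number of `+1`'s is the number of positive eigenvalues of `M`. -/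
theorem card_one_eq_card_pos_eigenvalues {P : Matrix ι ι ℂ} {d : ι → ℂ}
    (hP : IsUnit P.det) (hd : ∀ i, d i = 1 ∨ d i = -1) (hPM : Pᴴ * M * P = diagonal d) :
    (Finset.univ.filter fun i => d i = 1).card =
      (Finset.univ.filter fun i => 0 < hM.eigenvalues i).card := by
  have hdet := isUnit_det_of_conjTranspose_mul_eq_diagonal hd hPM
  obtain ⟨Q, hQ, hQM⟩ := exists_conjTranspose_mul_eq_diagonal_sign hM hdet
  rw [card_one_eq_of_conjTranspose_mul_eq_diagonal hP hQ hd (fun i => sgn_mem_pm _) hPM hQM]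
  congr 1
  ext i
  simp only [Finset.mem_filter, Finset.mem_univ, true_and, sgn_eq_one_iff]

/-- … and the number of `−1`'s is the number of negative eigenvalues. -/
theorem card_neg_one_eq_card_neg_eigenvalues {P : Matrix ι ι ℂ} {d : ι → ℂ}
    (hP : IsUnit P.det) (hd : ∀ i, d i = 1 ∨ d i = -1) (hPM : Pᴴ * M * P = diagonal d) :
    (Finset.univ.filter fun i => d i = -1).card =
      (Finset.univ.filter fun i => hM.eigenvalues i < 0).card := by
  have hdet := isUnit_det_of_conjTranspose_mul_eq_diagonal hd hPM
  obtain ⟨Q, hQ, hQM⟩ := exists_conjTranspose_mul_eq_diagonal_sign hM hdet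
  rw [card_neg_one_eq_of_conjTranspose_mul_eq_diagonal hP hQ hd (fun i => sgn_mem_pm _) hPM hQM]
  congr 1
  ext i
  simp only [Finset.mem_filter, Finset.mem_univ, true_and]
  exact sgn_eq_neg_one_iff (eigenvalues_ne_zero_of_isUnit_det hM hdet i)

end Spectral

/-- `p` in a normal form `diag(1^p, (−1)^q)` of a hermitian `M` is its number of positive
eigenvalues. -/
theorem eq_card_pos_eigenvalues_of_conjTranspose_mul_eq_diagonal_pmVec {n p : ℕ}
    {M P : Matrix (Fin n) (Fin n) ℂ} (hM : M.IsHermitian) (hp : p ≤ n) (hP : IsUnit P.det)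
    (hPM : Pᴴ * M * P = diagonal (pmVec n p)) :
    p = (Finset.univ.filter fun i => 0 < hM.eigenvalues i).card := by
  rw [← card_one_eq_card_pos_eigenvalues hM hP (pmVec_mem_pm n p) hPM, card_filter_pmVec_eq_one hp]

end Summit.Ventures.HodgeRepro2.T5HermitianInertiaSpectral
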